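import Summits.QuantumFields.YangMills.Theorems.BalabanUVNodesN27KeyedKnit

/-!
# BalabanUVNodes ∕ N27 = binder B5 AT THE RECORD, XXIVb — THE KEYED KNIT IN WORLD-FREE (θ-KEYED) FORM: «∀ θ h, Guard θ → Adm θ → HybridNE7Under (datumOf θ h) END»
# from the children's estimates keyed at an ABSTRACT parameter-tuple key — the SHAPE OF THE RE-PINNED ITEMS (director LINE №99 (2) form (i): the rev-10 texts K2′∕K3′ are
# θ-keyed on the SAME θ that produces the datum, threaded through a NAMED guard — print's partition of unity `Stage12Params.ZtUnity` — with NO `(D, w)` record pair)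
# (cell `pub-ymgap`, HUMAN RULING D-0062 Track A, R134 seat `pub-ymgap-dag-n27-c` (s2) gen 2; companion of XXIV `BalabanUVNodesN27KeyedKnit` (p459143), same abstract key
# `(Θ, Hp, Adm, datumOf)`, same characterised carrier records; `--supports` the K3 item stmt-QuantumFields-19676 until K3′ has an id; COUNT-NEUTRAL; stage-generic,
# restate- and re-pin-immune: imports XXIV only)

WHY.  XXIV concludes `Spine Rec` for a record predicate `Rec` linked to the key by (K1)∕(K2).  The re-pinned items drop the record pair: K3′ `SpineGivenEndpointR12 := ∀ F θ h,
θ.ZtUnity F 2 → θ.Admissible F 2 → (B) → END → HybridNE7Under (datumOfRecord₁₂ F 2 θ h) END` (plan g64 REV10-DRAFTS, INBOX l.13285).  This module gives the WORLD-FREE form once: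
at the «keyed-datum class» `fun F D _ => ∃ θ h, Adm θ ∧ D = datumOf θ h` (K1) is the identity and (K2) needs only SOME world (`Node00.nonempty_worldP`, the degenerate inhabitant —
never read: B5 does not read the world), so every XXIV join yields «∀ θ h, Adm θ → B5 at `datumOf θ h`»; a GUARD `G θ` (unity) is absorbed into `Adm` and curried back out.

WHAT IS KERNEL-CHECKED ([bookkeeping]; 0 `def`, 0 `sorry`; every stub ∕ face ∕ edge a HYPOTHESIS — 0∕1 at every record today).
* §1 `spine_keyedClass_iff_forall_keyed` — B5 at the keyed-datum class ⟺ the world-free keyed form.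
* §2 `forall_keyed_of_keyedFaces` — the world-free keyed form from XXIV's five same-tuple faces (N20 ∕ N21 at `cr`, K4's six rates at `rr` on the datum, the same-tuple N19′ edge, the
  keyed extraction clause) · `forall_guarded_of_keyedFaces` — the same with a guard `G θ` threaded through every face and the conclusion (K3′'s shape at `G := ZtUnity`,
  `Adm := Admissible`, up to the two displayed antecedents) · `forall_guardedWithAntecedents_of_keyedFaces` — with (B), END displayed (dropped: they are B5-under-END's own).
* §3 `forall_keyed_of_rateStubs_twoKeys` — the world-free keyed form from the stub instances of a divided carrier home (`SRec`∕`RRec` characterised by `cr`∕`rr`, K4∕K5 stubs at the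
  keyed-datum class, PAIR-FORM N19′ edge; XXIV `spine_of_rateStubs_twoKeys`) · `forall_keyed_of_rateStubs_twoKeys_of_datumDetermined` (canonical-key road).

HONEST FRAMING.  COMPOSITE-node bookkeeping over hypothesis SHAPES; `cr`, `rr`, the key, the guard are PARAMETERS; nothing of Bałaban's asserted or instantiated; NE7 ∕ NE7b ∕ NE7c NOT
PRINTED for d = 4 and NOT PROVED; NO node discharged; K3 HELD (R166), K3′ not yet born — neither claimed; counts UNMOVED (typed 28∕28 · discharged 5∕27, A 5∕28); one finite four-torus
programme at fixed `ε` — NOT ℝ⁴, NOT infinite volume, NOT OS, NOT a mass gap, NOT Clay.  No decl below carries a cite tag.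
-/

namespace Summit.QuantumFields.YangMills.Theorems.BalabanUVNodesN27SpineRecord

open Literature.MathematicalPhysics.QuantumFieldTheory.Balaban1983to89
open Literature.MathematicalPhysics.QuantumFieldTheory.Balaban1983to89.T4Continuum
open T4WeightBudget (RelWeightBound)
open T4IndicatorShell (ShellWeightBound)
open T4ContinuumYM4Torus (ForSmallCouplings)
open Summit.QuantumFields.BalabanUV.T4Continuum.Spine
open YMDAG.UVSplit

universe u

variable {N : ℕ} [NeZero N]
variable {Θ : T4Family → Type u} (Hp : ∀ {F : T4Family}, Θ F → Prop) (Adm : ∀ {F : T4Family}, Θ F → Prop)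
  (datumOf : ∀ {F : T4Family} (θ : Θ F), Hp θ → Datum F N)
  (SRec : SpineRecordPred N) (RRec : RateRecordPred N)
  (cr : ∀ {F : T4Family} (θ : Θ F), Hp θ → (ℕ → ℝ) → List (ULoop F) → SpineCarriers)
  (rr : ∀ {F : T4Family} (θ : Θ F), Hp θ → (ℕ → ℝ) → List (ULoop F) → RateCarriers N)

/-! ## §1 The keyed-datum class: B5 there ⟺ the world-free keyed form -/

section KeyedClass

/-- **B5 AT THE KEYED-DATUM CLASS ⟺ «∀ θ h, Adm θ → B5 at `datumOf θ h`»** (XXIV `spine_iff_forall_keyed` with (K1) the identity and (K2) the degenerate world `Node00.nonempty_worldP` —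
the class does not read the world, nor does B5). [bookkeeping] -/
theorem spine_keyedClass_iff_forall_keyed :
    Spine (N := N) (fun F D _ => ∃ (θ : Θ F) (h : Hp θ), Adm θ ∧ D = datumOf θ h) ↔
      ∀ (F : T4Family) (θ : Θ F) (hP : Hp θ), Adm θ →
        T4ApexHybrid.HybridNE7Under (datumOf θ hP) (DagBinding.EndpointExistence (datumOf θ hP).C.toB12) := by
  obtain ⟨w₀⟩ := Node00.nonempty_worldP
  exact spine_iff_forall_keyed Hp Adm datumOf _ (fun _ _ _ hR => hR) (fun F θ h hθ => ⟨w₀, θ, h, hθ, rfl⟩)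

end KeyedClass

/-! ## §2 The world-free keyed form from the same-tuple faces; a guard threaded through -/

section Faces

/-- **THE WORLD-FREE KEYED B5 FROM THE CHILDREN'S ESTIMATES READ OFF THE SAME TUPLE** (XXIV `spine_of_keyedFaces` at the keyed-datum class, then §1): N20 ∕ N21 at `cr θ h g₀ os`,
K4's six rates at `rr θ h g₀ os` on `datumOf θ h`, the same-tuple N19′ edge, the keyed extraction clause — for every admissible keyed θ — give «∀ θ h, Adm θ →
HybridNE7Under (datumOf θ h) END». [bookkeeping] -/
theorem forall_keyed_of_keyedFaces
    (h20 : ∀ (F : T4Family) (θ : Θ F) (hP : Hp θ), Adm θ → ∀ (g₀ : ℕ → ℝ) (os : List (ULoop F)),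
      RelWeightBound (cr θ hP g₀ os).l₀ (cr θ hP g₀ os).T (cr θ hP g₀ os).A (cr θ hP g₀ os).B (cr θ hP g₀ os).Bad (cr θ hP g₀ os).W)
    (h21 : ∀ (F : T4Family) (θ : Θ F) (hP : Hp θ), Adm θ → ∀ (g₀ : ℕ → ℝ) (os : List (ULoop F)),
      ShellWeightBound (cr θ hP g₀ os).l₀ (cr θ hP g₀ os).T (cr θ hP g₀ os).A (cr θ hP g₀ os).B (cr θ hP g₀ os).shA (cr θ hP g₀ os).shB (cr θ hP g₀ os).Wsh)
    (hrates : ∀ (F : T4Family) (θ : Θ F) (hP : Hp θ), Adm θ → ∀ (g₀ : ℕ → ℝ) (os : List (ULoop F)), RatesAt (datumOf θ hP) (rr θ hP g₀ os))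
    (h19 : ∀ (F : T4Family) (θ : Θ F) (hP : Hp θ), Adm θ → ∀ (g₀ : ℕ → ℝ) (os : List (ULoop F)),
      RatesAt (datumOf θ hP) (rr θ hP g₀ os) → letI := (cr θ hP g₀ os).dec
        ∃ δ : ℕ → ℝ, NE7.Core (cr θ hP g₀ os).l₀ (cr θ hP g₀ os).vol (cr θ hP g₀ os).T (cr θ hP g₀ os).Bad
          (fun K t τ => (cr θ hP g₀ os).A K t τ - (cr θ hP g₀ os).shA K t τ) (fun K t τ => (cr θ hP g₀ os).B K t τ - (cr θ hP g₀ os).shB K t τ) δ ∧ Summable δ)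
    (hx : ∀ (F : T4Family) (θ : Θ F) (hP : Hp θ), Adm θ →
      B16.EndStatementBPrinted (datumOf θ hP).C → DagBinding.EndpointExistence (datumOf θ hP).C.toB12 →
        ForSmallCouplings (datumOf θ hP) fun g₀ => ∀ os : List (ULoop F),
          0 < (cr θ hP g₀ os).l₀ ∧ 0 < (cr θ hP g₀ os).vol ∧
          (∀ (K : ℕ) (t : ℝ), |t| ≤ (cr θ hP g₀ os).l₀ →
            T4GenFunBounds.schemeZ ((datumOf θ hP).scheme g₀) os ((cr θ hP g₀ os).K₀ + K) t = ∑ τ ∈ (cr θ hP g₀ os).T K, (cr θ hP g₀ os).A K t τ) ∧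
          (∀ (K : ℕ) (t : ℝ), |t| ≤ (cr θ hP g₀ os).l₀ →
            T4GenFunBounds.schemeZ ((datumOf θ hP).scheme g₀) os ((cr θ hP g₀ os).K₀ + K + 1) t = ∑ τ ∈ (cr θ hP g₀ os).T K, (cr θ hP g₀ os).B K t τ))
    (F : T4Family) (θ : Θ F) (hP : Hp θ) (hθ : Adm θ) :
    T4ApexHybrid.HybridNE7Under (datumOf θ hP) (DagBinding.EndpointExistence (datumOf θ hP).C.toB12) :=
  (spine_keyedClass_iff_forall_keyed Hp Adm datumOf).mp
    (spine_of_keyedFaces Hp Adm datumOf _ cr rr (fun _ _ _ hR => hR) h20 h21 hrates h19 hx) F θ hP hθ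

variable (G : ∀ {F : T4Family}, Θ F → Prop)

/-- **A GUARD THREADED THROUGH** (the re-pinned items' shape: `G := Stage12Params.ZtUnity`, `Adm := Stage12Params.Admissible`): if the five faces are asked only of tuples with `G θ`
and `Adm θ`, then «∀ θ h, G θ → Adm θ → HybridNE7Under (datumOf θ h) END» (§2 at the key `Adm' := G ∧ Adm`, curried). [bookkeeping] -/
theorem forall_guarded_of_keyedFaces
    (h20 : ∀ (F : T4Family) (θ : Θ F) (hP : Hp θ), G θ → Adm θ → ∀ (g₀ : ℕ → ℝ) (os : List (ULoop F)),
      RelWeightBound (cr θ hP g₀ os).l₀ (cr θ hP g₀ os).T (cr θ hP g₀ os).A (cr θ hP g₀ os).B (cr θ hP g₀ os).Bad (cr θ hP g₀ os).W)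
    (h21 : ∀ (F : T4Family) (θ : Θ F) (hP : Hp θ), G θ → Adm θ → ∀ (g₀ : ℕ → ℝ) (os : List (ULoop F)),
      ShellWeightBound (cr θ hP g₀ os).l₀ (cr θ hP g₀ os).T (cr θ hP g₀ os).A (cr θ hP g₀ os).B (cr θ hP g₀ os).shA (cr θ hP g₀ os).shB (cr θ hP g₀ os).Wsh)
    (hrates : ∀ (F : T4Family) (θ : Θ F) (hP : Hp θ), G θ → Adm θ → ∀ (g₀ : ℕ → ℝ) (os : List (ULoop F)), RatesAt (datumOf θ hP) (rr θ hP g₀ os))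
    (h19 : ∀ (F : T4Family) (θ : Θ F) (hP : Hp θ), G θ → Adm θ → ∀ (g₀ : ℕ → ℝ) (os : List (ULoop F)),
      RatesAt (datumOf θ hP) (rr θ hP g₀ os) → letI := (cr θ hP g₀ os).dec
        ∃ δ : ℕ → ℝ, NE7.Core (cr θ hP g₀ os).l₀ (cr θ hP g₀ os).vol (cr θ hP g₀ os).T (cr θ hP g₀ os).Bad
          (fun K t τ => (cr θ hP g₀ os).A K t τ - (cr θ hP g₀ os).shA K t τ) (fun K t τ => (cr θ hP g₀ os).B K t τ - (cr θ hP g₀ os).shB K t τ) δ ∧ Summable δ)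
    (hx : ∀ (F : T4Family) (θ : Θ F) (hP : Hp θ), G θ → Adm θ →
      B16.EndStatementBPrinted (datumOf θ hP).C → DagBinding.EndpointExistence (datumOf θ hP).C.toB12 →
        ForSmallCouplings (datumOf θ hP) fun g₀ => ∀ os : List (ULoop F),
          0 < (cr θ hP g₀ os).l₀ ∧ 0 < (cr θ hP g₀ os).vol ∧
          (∀ (K : ℕ) (t : ℝ), |t| ≤ (cr θ hP g₀ os).l₀ →
            T4GenFunBounds.schemeZ ((datumOf θ hP).scheme g₀) os ((cr θ hP g₀ os).K₀ + K) t = ∑ τ ∈ (cr θ hP g₀ os).T K, (cr θ hP g₀ os).A K t τ) ∧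
          (∀ (K : ℕ) (t : ℝ), |t| ≤ (cr θ hP g₀ os).l₀ →
            T4GenFunBounds.schemeZ ((datumOf θ hP).scheme g₀) os ((cr θ hP g₀ os).K₀ + K + 1) t = ∑ τ ∈ (cr θ hP g₀ os).T K, (cr θ hP g₀ os).B K t τ))
    (F : T4Family) (θ : Θ F) (hP : Hp θ) (hG : G θ) (hθ : Adm θ) :
    T4ApexHybrid.HybridNE7Under (datumOf θ hP) (DagBinding.EndpointExistence (datumOf θ hP).C.toB12) :=
  forall_keyed_of_keyedFaces Hp (fun θ => G θ ∧ Adm θ) datumOf cr rr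
    (fun F θ hP hA => h20 F θ hP hA.1 hA.2) (fun F θ hP hA => h21 F θ hP hA.1 hA.2) (fun F θ hP hA => hrates F θ hP hA.1 hA.2)
    (fun F θ hP hA => h19 F θ hP hA.1 hA.2) (fun F θ hP hA => hx F θ hP hA.1 hA.2) F θ hP ⟨hG, hθ⟩

/-- **THE SAME WITH THE TWO DISPLAYED ANTECEDENTS (B), END** — literally the re-pinned item's text shape «∀ θ h, G θ → Adm θ → (B) → END → HybridNE7Under (datumOf θ h) END»; the antecedents
are B5-under-END's own and are dropped (XX §4 `k3Shape_iff_spine_rec11C`'s mechanism). [bookkeeping] -/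
theorem forall_guardedWithAntecedents_of_keyedFaces
    (h20 : ∀ (F : T4Family) (θ : Θ F) (hP : Hp θ), G θ → Adm θ → ∀ (g₀ : ℕ → ℝ) (os : List (ULoop F)),
      RelWeightBound (cr θ hP g₀ os).l₀ (cr θ hP g₀ os).T (cr θ hP g₀ os).A (cr θ hP g₀ os).B (cr θ hP g₀ os).Bad (cr θ hP g₀ os).W)
    (h21 : ∀ (F : T4Family) (θ : Θ F) (hP : Hp θ), G θ → Adm θ → ∀ (g₀ : ℕ → ℝ) (os : List (ULoop F)),
      ShellWeightBound (cr θ hP g₀ os).l₀ (cr θ hP g₀ os).T (cr θ hP g₀ os).A (cr θ hP g₀ os).B (cr θ hP g₀ os).shA (cr θ hP g₀ os).shB (cr θ hP g₀ os).Wsh)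
    (hrates : ∀ (F : T4Family) (θ : Θ F) (hP : Hp θ), G θ → Adm θ → ∀ (g₀ : ℕ → ℝ) (os : List (ULoop F)), RatesAt (datumOf θ hP) (rr θ hP g₀ os))
    (h19 : ∀ (F : T4Family) (θ : Θ F) (hP : Hp θ), G θ → Adm θ → ∀ (g₀ : ℕ → ℝ) (os : List (ULoop F)),
      RatesAt (datumOf θ hP) (rr θ hP g₀ os) → letI := (cr θ hP g₀ os).dec
        ∃ δ : ℕ → ℝ, NE7.Core (cr θ hP g₀ os).l₀ (cr θ hP g₀ os).vol (cr θ hP g₀ os).T (cr θ hP g₀ os).Bad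
          (fun K t τ => (cr θ hP g₀ os).A K t τ - (cr θ hP g₀ os).shA K t τ) (fun K t τ => (cr θ hP g₀ os).B K t τ - (cr θ hP g₀ os).shB K t τ) δ ∧ Summable δ)
    (hx : ∀ (F : T4Family) (θ : Θ F) (hP : Hp θ), G θ → Adm θ →
      B16.EndStatementBPrinted (datumOf θ hP).C → DagBinding.EndpointExistence (datumOf θ hP).C.toB12 →
        ForSmallCouplings (datumOf θ hP) fun g₀ => ∀ os : List (ULoop F),
          0 < (cr θ hP g₀ os).l₀ ∧ 0 < (cr θ hP g₀ os).vol ∧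
          (∀ (K : ℕ) (t : ℝ), |t| ≤ (cr θ hP g₀ os).l₀ →
            T4GenFunBounds.schemeZ ((datumOf θ hP).scheme g₀) os ((cr θ hP g₀ os).K₀ + K) t = ∑ τ ∈ (cr θ hP g₀ os).T K, (cr θ hP g₀ os).A K t τ) ∧
          (∀ (K : ℕ) (t : ℝ), |t| ≤ (cr θ hP g₀ os).l₀ →
            T4GenFunBounds.schemeZ ((datumOf θ hP).scheme g₀) os ((cr θ hP g₀ os).K₀ + K + 1) t = ∑ τ ∈ (cr θ hP g₀ os).T K, (cr θ hP g₀ os).B K t τ))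
    (F : T4Family) (θ : Θ F) (hP : Hp θ) (hG : G θ) (hθ : Adm θ) (_hB : B16.EndStatementBPrinted (datumOf θ hP).C)
    (_hE : DagBinding.EndpointExistence (datumOf θ hP).C.toB12) :
    T4ApexHybrid.HybridNE7Under (datumOf θ hP) (DagBinding.EndpointExistence (datumOf θ hP).C.toB12) :=
  forall_guarded_of_keyedFaces Hp Adm datumOf cr rr G h20 h21 hrates h19 hx F θ hP hG hθ

end Faces

/-! ## §3 The world-free keyed form from the stub instances of a divided carrier home -/

section TwoKeys

variable
  (hkeyS : ∀ (F : T4Family) (D : Datum F N) (g₀ : ℕ → ℝ) (os : List (ULoop F)) (S : SpineCarriers), SRec F D g₀ os S ↔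
    ∃ (θ : Θ F) (h : Hp θ), Adm θ ∧ D = datumOf θ h ∧ S = cr θ h g₀ os)
  (hkeyR : ∀ (F : T4Family) (D : Datum F N) (g₀ : ℕ → ℝ) (os : List (ULoop F)) (R : RateCarriers N), RRec F D g₀ os R ↔
    ∃ (θ : Θ F) (h : Hp θ), Adm θ ∧ D = datumOf θ h ∧ R = rr θ h g₀ os)
include hkeyS hkeyR

/-- **THE WORLD-FREE KEYED B5 FROM THE DIVIDED CARRIER HOME** (XXIV `spine_of_rateStubs_twoKeys` at the keyed-datum class, then §1): K4 stubs `S_R00x _ RRec` (free here, XXIV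
`s_R00x_of_keyed`), `S_N14`–`S_N18`, `S_N22` at `RRec`, K5 stubs `S_N27x _ SRec`, `S_N20`, `S_N21` at `SRec` — the record predicate of `S_R00x`∕`S_N27x` being the keyed-datum class
itself — and the PAIR-FORM N19′ edge ⇒ «∀ θ h, Adm θ → HybridNE7Under (datumOf θ h) END». [bookkeeping] -/
theorem forall_keyed_of_rateStubs_twoKeys
    (hx : S_R00x (fun F D _ => ∃ (θ : Θ F) (h : Hp θ), Adm θ ∧ D = datumOf θ h) RRec) (h14 : S_N14 RRec) (h15 : S_N15 RRec) (h16 : S_N16 RRec)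
    (h17 : S_N17 RRec) (h18 : S_N18 RRec) (h22 : S_N22 RRec) (hx' : S_N27x (fun F D _ => ∃ (θ : Θ F) (h : Hp θ), Adm θ ∧ D = datumOf θ h) SRec)
    (h20 : S_N20 SRec) (h21 : S_N21 SRec)
    (h19₂ : ∀ (F : T4Family) (θ : Θ F) (hP : Hp θ) (θ' : Θ F) (hP' : Hp θ'), Adm θ → Adm θ' → datumOf θ' hP' = datumOf θ hP →
      ∀ (g₀ : ℕ → ℝ) (os : List (ULoop F)), RatesAt (datumOf θ hP) (rr θ' hP' g₀ os) → letI := (cr θ hP g₀ os).dec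
        ∃ δ : ℕ → ℝ, NE7.Core (cr θ hP g₀ os).l₀ (cr θ hP g₀ os).vol (cr θ hP g₀ os).T (cr θ hP g₀ os).Bad
          (fun K t τ => (cr θ hP g₀ os).A K t τ - (cr θ hP g₀ os).shA K t τ) (fun K t τ => (cr θ hP g₀ os).B K t τ - (cr θ hP g₀ os).shB K t τ) δ ∧ Summable δ)
    (F : T4Family) (θ : Θ F) (hP : Hp θ) (hθ : Adm θ) :
    T4ApexHybrid.HybridNE7Under (datumOf θ hP) (DagBinding.EndpointExistence (datumOf θ hP).C.toB12) :=
  (spine_keyedClass_iff_forall_keyed Hp Adm datumOf).mp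
    (spine_of_rateStubs_twoKeys Hp Adm datumOf _ SRec RRec cr rr hkeyS hkeyR hx h14 h15 h16 h17 h18 h22 hx' h20 h21 h19₂) F θ hP hθ

/-- **THE CANONICAL-KEY ROAD, WORLD-FREE**: with a DATUM-DETERMINED rate reading the single-tuple N19′ edge suffices (XXIV `pairEdge_of_datumDetermined`). [bookkeeping] -/
theorem forall_keyed_of_rateStubs_twoKeys_of_datumDetermined
    (hdetR : ∀ (F : T4Family) (θ : Θ F) (hP : Hp θ) (θ' : Θ F) (hP' : Hp θ'), Adm θ → Adm θ' → datumOf θ' hP' = datumOf θ hP →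
      ∀ (g₀ : ℕ → ℝ) (os : List (ULoop F)), rr θ' hP' g₀ os = rr θ hP g₀ os)
    (hx : S_R00x (fun F D _ => ∃ (θ : Θ F) (h : Hp θ), Adm θ ∧ D = datumOf θ h) RRec) (h14 : S_N14 RRec) (h15 : S_N15 RRec) (h16 : S_N16 RRec)
    (h17 : S_N17 RRec) (h18 : S_N18 RRec) (h22 : S_N22 RRec) (hx' : S_N27x (fun F D _ => ∃ (θ : Θ F) (h : Hp θ), Adm θ ∧ D = datumOf θ h) SRec)
    (h20 : S_N20 SRec) (h21 : S_N21 SRec)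
    (h19 : ∀ (F : T4Family) (θ : Θ F) (hP : Hp θ), Adm θ → ∀ (g₀ : ℕ → ℝ) (os : List (ULoop F)),
      RatesAt (datumOf θ hP) (rr θ hP g₀ os) → letI := (cr θ hP g₀ os).dec
        ∃ δ : ℕ → ℝ, NE7.Core (cr θ hP g₀ os).l₀ (cr θ hP g₀ os).vol (cr θ hP g₀ os).T (cr θ hP g₀ os).Bad
          (fun K t τ => (cr θ hP g₀ os).A K t τ - (cr θ hP g₀ os).shA K t τ) (fun K t τ => (cr θ hP g₀ os).B K t τ - (cr θ hP g₀ os).shB K t τ) δ ∧ Summable δ)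
    (F : T4Family) (θ : Θ F) (hP : Hp θ) (hθ : Adm θ) :
    T4ApexHybrid.HybridNE7Under (datumOf θ hP) (DagBinding.EndpointExistence (datumOf θ hP).C.toB12) :=
  forall_keyed_of_rateStubs_twoKeys Hp Adm datumOf SRec RRec cr rr hkeyS hkeyR hx h14 h15 h16 h17 h18 h22 hx' h20 h21
    (pairEdge_of_datumDetermined Hp Adm datumOf cr rr hdetR h19) F θ hP hθ

end TwoKeys

end Summit.QuantumFields.YangMills.Theorems.BalabanUVNodesN27SpineRecord
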